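import Summits.MatrixMultiplication.MatrixMultiplication.Theorems.SoloBlindWindowTwo

/-!
# Lemmas for the window inequality (E≤3) in all ranks (solo-blind, door I1⁗ / (K₃), s80)

Setting of `SoloBlindWindowTwo`: `h : ι → G` (`G` abelian of exponent `3`) zero-sum free on the finite index set
`S`, and `τ` H-GOOD: no sub-sum over `S` equals `τ + τ` (i.e. `h ∪ {τ}` is zero-sum free).  Index-level lemmas
used by `SoloBlindWindowThree`:

* `soloBlind_hgood_not_disjoint` — two disjoint representations of `τ` cannot coexist;
* `soloBlind_hgood_value_tau_kills`, `soloBlind_hgood_valueClass_tau_le_one` — an index of value `τ` excludes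
  every representation of size `≥ 2`, and there is at most one such index;
* `soloBlind_hgood_pair_values_ne` — a pair representing `τ` has two different values;
* `soloBlind_triple_not_both` — a triple representing `τ` never contains a pair representing `τ`;
* `soloBlind_two_pairs_share` — two distinct meeting pairs with one target have the shape `{u,v}, {u',v}`;
* `soloBlind_hgood_two_pairs_no_triple` — two pairs `{x,y}`, `{x',y}` representing `τ` exclude all triples
  (`{x,x',k}` forces `{k,y}` to have sum `τ+τ`; a triple through `y` gives the zero-sum `{u,v,x,x'}`);
* `soloBlind_hgood_triples_le_links` — with a pair `{x,y}` representing `τ`, `N_3 ≤ A_x + A_y` where `A_x`, `A_y`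
  count the pairs in `S ∖ {x,y}` with sum `h y`, resp. `h x`;
* `soloBlind_hgood_of_outside_value` — `S'` missing an index of value `b` is H-good for `b`.
-/

namespace Summit.MatrixMultiplication.MatrixMultiplication.Theorems

open Finset

variable {ι G : Type*} [DecidableEq ι] [AddCommGroup G] [DecidableEq G]

/-- Under H-goodness two disjoint representations of `τ` (of any sizes) cannot coexist. -/
theorem soloBlind_hgood_not_disjoint {h : ι → G} {S : Finset ι} {τ : G}
    (hgood : ∀ T ⊆ S, ∑ i ∈ T, h i ≠ τ + τ) {k k' : ℕ} {T U : Finset ι}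
    (hT : T ∈ soloBlindSeqRep h S k τ) (hU : U ∈ soloBlindSeqRep h S k' τ) (hd : Disjoint T U) :
    False := by
  obtain ⟨hTS, _, hsT⟩ := soloBlind_mem_seqRep.mp hT
  obtain ⟨hUS, _, hsU⟩ := soloBlind_mem_seqRep.mp hU
  exact hgood _ (Finset.union_subset hTS hUS) (by rw [Finset.sum_union hd, hsT, hsU])

/-- An index of value `τ` excludes every representation of size `≥ 2`. -/
theorem soloBlind_hgood_value_tau_kills {h : ι → G} {S : Finset ι}
    (zsf : ∀ T ⊆ S, T.Nonempty → ∑ i ∈ T, h i ≠ 0) {τ : G}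
    (hgood : ∀ T ⊆ S, ∑ i ∈ T, h i ≠ τ + τ) {p : ι} (hp : p ∈ S) (hpτ : h p = τ)
    {k : ℕ} (hk : 2 ≤ k) {T : Finset ι} (hT : T ∈ soloBlindSeqRep h S k τ) : False := by
  obtain ⟨hTS, hcard, hsum⟩ := soloBlind_mem_seqRep.mp hT
  by_cases hpT : p ∈ T
  · have e := Finset.add_sum_erase T h hpT
    rw [hsum, hpτ] at e
    have hz : ∑ i ∈ T.erase p, h i = 0 := by
      have e' : τ + ∑ i ∈ T.erase p, h i = τ + 0 := by rw [e, add_zero]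
      exact add_left_cancel e'
    have hne : (T.erase p).Nonempty :=
      Finset.card_pos.mp (by rw [Finset.card_erase_of_mem hpT]; omega)
    exact zsf _ ((Finset.erase_subset p T).trans hTS) hne hz
  · have e : ∑ i ∈ insert p T, h i = τ + τ := by rw [Finset.sum_insert hpT, hpτ, hsum]
    exact hgood _ (Finset.insert_subset hp hTS) e

/-- At most one index carries the value `τ`. -/
theorem soloBlind_hgood_valueClass_tau_le_one {h : ι → G} {S : Finset ι} {τ : G}
    (hgood : ∀ T ⊆ S, ∑ i ∈ T, h i ≠ τ + τ) : (S.filter (fun i => h i = τ)).card ≤ 1 := by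
  by_contra hlt
  obtain ⟨Z, hZsub, hZcard⟩ :=
    Finset.exists_subset_card_eq (show 2 ≤ (S.filter (fun i => h i = τ)).card by omega)
  obtain ⟨p, q, hpq, rfl⟩ := Finset.card_eq_two.mp hZcard
  have hp := Finset.mem_filter.mp (hZsub (Finset.mem_insert_self p {q}))
  have hq := Finset.mem_filter.mp (hZsub (Finset.mem_insert_of_mem (Finset.mem_singleton_self q)))
  exact hgood {p, q} (fun z hz => (Finset.mem_filter.mp (hZsub hz)).1)
    (by rw [Finset.sum_pair hpq, hp.2, hq.2])

/-- A pair representing `τ` has two different values (a twin pair `{x,x'}` with `h x + h x = τ` would make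
`h x = τ + τ` a forbidden one-element sub-sum). -/
theorem soloBlind_hgood_pair_values_ne (three : ∀ g : G, g + g + g = 0) {h : ι → G} {S : Finset ι}
    {τ : G} (hgood : ∀ T ⊆ S, ∑ i ∈ T, h i ≠ τ + τ) {x y : ι}
    (hP : ({x, y} : Finset ι) ∈ soloBlindSeqRep h S 2 τ) : h x ≠ h y := by
  obtain ⟨hPS, hcard, hsum⟩ := soloBlind_mem_seqRep.mp hP
  have hxy : x ≠ y := by
    intro e; rw [e] at hcard; simp at hcard
  rw [Finset.sum_pair hxy] at hsum
  intro heq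
  rw [← heq] at hsum
  have hx : h x = τ + τ := by
    rw [← hsum]
    have t := three (h x)
    calc h x = h x + 0 := (add_zero _).symm
      _ = h x + (h x + h x + h x) := by rw [t]
      _ = h x + h x + (h x + h x) := by abel
  have hxS : x ∈ S := hPS (Finset.mem_insert_self x {y})
  exact hgood {x} (Finset.singleton_subset_iff.mpr hxS) (by rw [Finset.sum_singleton]; exact hx)

/-- A triple representing `τ` cannot contain a whole pair representing `τ` (the third value would be `0`). -/
theorem soloBlind_triple_not_both {h : ι → G} {S : Finset ι}
    (zsf : ∀ T ⊆ S, T.Nonempty → ∑ i ∈ T, h i ≠ 0) {τ : G} {x y : ι}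
    (hP : ({x, y} : Finset ι) ∈ soloBlindSeqRep h S 2 τ) {M : Finset ι}
    (hM : M ∈ soloBlindSeqRep h S 3 τ) (hxM : x ∈ M) (hyM : y ∈ M) : False := by
  obtain ⟨hPS, hPc, hPsum⟩ := soloBlind_mem_seqRep.mp hP
  obtain ⟨hMS, hMc, hMsum⟩ := soloBlind_mem_seqRep.mp hM
  have hxy : x ≠ y := by
    intro e; rw [e] at hPc; simp at hPc
  rw [Finset.sum_pair hxy] at hPsum
  have hyMx : y ∈ M.erase x := Finset.mem_erase.mpr ⟨fun e => hxy e.symm, hyM⟩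
  have hKc : ((M.erase x).erase y).card = 1 := by
    rw [Finset.card_erase_of_mem hyMx, Finset.card_erase_of_mem hxM, hMc]
  obtain ⟨k, hK⟩ := Finset.card_eq_one.mp hKc
  have e1 := Finset.add_sum_erase M h hxM
  have e2 := Finset.add_sum_erase (M.erase x) h hyMx
  rw [hK, Finset.sum_singleton] at e2
  rw [← e2, hMsum, ← hPsum] at e1
  -- e1 : h x + (h y + h k) = h x + h y
  have hk0 : h k = 0 := by
    have e3 : h x + h y + h k = h x + h y + 0 := by rw [add_zero, add_assoc]; exact e1
    exact add_left_cancel e3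
  have hkM : k ∈ (M.erase x).erase y := by rw [hK]; exact Finset.mem_singleton_self k
  have hkS : k ∈ S := hMS ((Finset.erase_subset _ _) ((Finset.erase_subset _ _) hkM))
  exact zsf {k} (Finset.singleton_subset_iff.mpr hkS) (Finset.singleton_nonempty k)
    (by rw [Finset.sum_singleton]; exact hk0)

/-- Two distinct meeting pairs with the same target have the shape `{u, v}, {u', v}` (shared index `v`). -/
theorem soloBlind_two_pairs_share {h : ι → G} {W : Finset ι} {σ : G} {Q₁ Q₂ : Finset ι}
    (h₁ : Q₁ ∈ soloBlindSeqRep h W 2 σ) (h₂ : Q₂ ∈ soloBlindSeqRep h W 2 σ) (hne : Q₁ ≠ Q₂)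
    (hmeet : ¬ Disjoint Q₁ Q₂) :
    ∃ u u' v : ι, u ∈ W ∧ u' ∈ W ∧ v ∈ W ∧ u ≠ u' ∧ u ≠ v ∧ u' ≠ v ∧ h u + h v = σ ∧ h u' + h v = σ ∧
      Q₁ = {u, v} ∧ Q₂ = {u', v} := by
  obtain ⟨u₁, v₁, huv₁, rfl, hu₁, hv₁, hs₁⟩ := soloBlind_mem_seqRep_two h₁
  obtain ⟨u₂, v₂, huv₂, rfl, hu₂, hv₂, hs₂⟩ := soloBlind_mem_seqRep_two h₂
  by_cases e1 : u₁ = u₂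
  · rw [← e1] at hs₂ hne huv₂
    refine ⟨v₁, v₂, u₁, hv₁, hv₂, hu₁, fun e => hne (by rw [e]), huv₁.symm, huv₂.symm,
      by rw [add_comm]; exact hs₁, by rw [add_comm]; exact hs₂, Finset.pair_comm _ _, ?_⟩
    rw [← e1, Finset.pair_comm]
  by_cases e2 : u₁ = v₂
  · rw [← e2] at hs₂ hne huv₂ hv₂
    refine ⟨v₁, u₂, u₁, hv₁, hu₂, hu₁, fun e => hne (by rw [e, Finset.pair_comm]), huv₁.symm, huv₂,
      by rw [add_comm]; exact hs₁, hs₂, Finset.pair_comm _ _, ?_⟩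
    rw [← e2]
  by_cases e3 : v₁ = u₂
  · rw [← e3] at hs₂ hne huv₂ hu₂
    refine ⟨u₁, v₂, v₁, hu₁, hv₂, hv₁, fun e => hne (by rw [e, Finset.pair_comm]), huv₁, huv₂.symm,
      hs₁, by rw [add_comm]; exact hs₂, rfl, ?_⟩
    rw [← e3, Finset.pair_comm]
  by_cases e4 : v₁ = v₂
  · rw [← e4] at hs₂ hne huv₂ hv₂
    refine ⟨u₁, u₂, v₁, hu₁, hu₂, hv₁, fun e => hne (by rw [e]), huv₁, huv₂, hs₁, hs₂, rfl, ?_⟩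
    rw [← e4]
  exfalso
  apply hmeet
  rw [Finset.disjoint_left]
  intro a ha
  simp only [Finset.mem_insert, Finset.mem_singleton] at ha
  simp only [Finset.mem_insert, Finset.mem_singleton, not_or]
  rcases ha with ha | ha
  · rw [ha]; exact ⟨e1, e2⟩
  · rw [ha]; exact ⟨e3, e4⟩

/-- TWO PAIRS EXCLUDE ALL TRIPLES: if `{x, y}` and `{x', y}` (`x ≠ x'`) both represent `τ`, no triple does. -/
theorem soloBlind_hgood_two_pairs_no_triple (three : ∀ g : G, g + g + g = 0) {h : ι → G} {S : Finset ι}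
    (zsf : ∀ T ⊆ S, T.Nonempty → ∑ i ∈ T, h i ≠ 0) {τ : G}
    (hgood : ∀ T ⊆ S, ∑ i ∈ T, h i ≠ τ + τ) {x x' y : ι}
    (hP : ({x, y} : Finset ι) ∈ soloBlindSeqRep h S 2 τ)
    (hP' : ({x', y} : Finset ι) ∈ soloBlindSeqRep h S 2 τ) (hxx' : x ≠ x')
    {M : Finset ι} (hM : M ∈ soloBlindSeqRep h S 3 τ) : False := by
  obtain ⟨hPS, hPc, hPsum⟩ := soloBlind_mem_seqRep.mp hP
  obtain ⟨hP'S, hP'c, hP'sum⟩ := soloBlind_mem_seqRep.mp hP'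
  have hxy : x ≠ y := by
    intro e; rw [e] at hPc; simp at hPc
  have hx'y : x' ≠ y := by
    intro e; rw [e] at hP'c; simp at hP'c
  rw [Finset.sum_pair hxy] at hPsum
  rw [Finset.sum_pair hx'y] at hP'sum
  have hxx'v : h x' = h x := add_right_cancel (hP'sum.trans hPsum.symm)
  obtain ⟨hMS, hMc, hMsum⟩ := soloBlind_mem_seqRep.mp hM
  have hxS : x ∈ S := hPS (Finset.mem_insert_self x {y})
  have hx'S : x' ∈ S := hP'S (Finset.mem_insert_self x' {y})
  have hyS : y ∈ S := hPS (Finset.mem_insert_of_mem (Finset.mem_singleton_self y))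
  by_cases hyM : y ∈ M
  · -- Q := M.erase y has sum h x, avoids x and x', and Q ∪ {x, x'} is a zero-sum
    have hQsum : ∑ i ∈ M.erase y, h i = h x := by
      have e := Finset.add_sum_erase M h hyM
      rw [hMsum, ← hPsum] at e
      have e' : h y + ∑ i ∈ M.erase y, h i = h y + h x := by rw [e, add_comm]
      exact add_left_cancel e'
    have hxQ : x ∉ M.erase y := fun hx =>
      soloBlind_triple_not_both zsf hP hM (Finset.mem_of_mem_erase hx) hyM
    have hx'Q : x' ∉ M.erase y := fun hx' =>
      soloBlind_triple_not_both zsf hP' hM (Finset.mem_of_mem_erase hx') hyM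
    have hd : Disjoint (M.erase y) {x, x'} := by
      rw [Finset.disjoint_right]
      intro w hw
      simp only [Finset.mem_insert, Finset.mem_singleton] at hw
      rcases hw with hw | hw
      · rw [hw]; exact hxQ
      · rw [hw]; exact hx'Q
    have hZ : ∑ i ∈ M.erase y ∪ {x, x'}, h i = 0 := by
      rw [Finset.sum_union hd, Finset.sum_pair hxx', hQsum, hxx'v, ← add_assoc]
      exact three (h x)
    exact zsf _ (Finset.union_subset ((Finset.erase_subset _ _).trans hMS)
        (Finset.insert_subset hxS (Finset.singleton_subset_iff.mpr hx'S)))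
      ⟨x, Finset.mem_union_right _ (Finset.mem_insert_self x {x'})⟩ hZ
  · -- y ∉ M: M meets both pairs, so x, x' ∈ M, M = {x, x', k}, and {k, y} has sum τ + τ
    have hxM : x ∈ M := by
      by_contra hxM
      refine soloBlind_hgood_not_disjoint hgood hM hP (Finset.disjoint_right.mpr ?_)
      intro w hw
      simp only [Finset.mem_insert, Finset.mem_singleton] at hw
      rcases hw with hw | hw
      · rw [hw]; exact hxM
      · rw [hw]; exact hyM
    have hx'M : x' ∈ M := by
      by_contra hx'M
      refine soloBlind_hgood_not_disjoint hgood hM hP' (Finset.disjoint_right.mpr ?_)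
      intro w hw
      simp only [Finset.mem_insert, Finset.mem_singleton] at hw
      rcases hw with hw | hw
      · rw [hw]; exact hx'M
      · rw [hw]; exact hyM
    have hx'Mx : x' ∈ M.erase x := Finset.mem_erase.mpr ⟨fun e => hxx' e.symm, hx'M⟩
    have hKc : ((M.erase x).erase x').card = 1 := by
      rw [Finset.card_erase_of_mem hx'Mx, Finset.card_erase_of_mem hxM, hMc]
    obtain ⟨k, hK⟩ := Finset.card_eq_one.mp hKc
    have e1 := Finset.add_sum_erase M h hxM
    have e2 := Finset.add_sum_erase (M.erase x) h hx'Mx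
    rw [hK, Finset.sum_singleton, hxx'v] at e2
    rw [← e2, hMsum] at e1
    -- e1 : h x + (h x + h k) = τ ;  hPsum : h x + h y = τ
    have hkM : k ∈ M := by
      have hk : k ∈ (M.erase x).erase x' := by rw [hK]; exact Finset.mem_singleton_self k
      exact Finset.mem_of_mem_erase (Finset.mem_of_mem_erase hk)
    have hkS : k ∈ S := hMS hkM
    have hky : k ≠ y := fun e => hyM (e ▸ hkM)
    have hsum2 : h k + h y = τ + τ := by
      have e3 : h k + h y = (h x + (h x + h k)) + (h x + h y) - (h x + h x + h x) := by abel
      rw [e1, hPsum, three (h x), sub_zero] at e3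
      exact e3
    exact hgood {k, y} (Finset.insert_subset hkS (Finset.singleton_subset_iff.mpr hyS))
      (by rw [Finset.sum_pair hky]; exact hsum2)

/-- With a pair `{x, y}` representing `τ`, every triple passes through `x` or `y` (not both), so
`N_3 ≤ A_x + A_y` with `A_x` = pairs in `S ∖ {x,y}` with sum `h y` and `A_y` = pairs with sum `h x`. -/
theorem soloBlind_hgood_triples_le_links {h : ι → G} {S : Finset ι}
    (zsf : ∀ T ⊆ S, T.Nonempty → ∑ i ∈ T, h i ≠ 0) {τ : G}
    (hgood : ∀ T ⊆ S, ∑ i ∈ T, h i ≠ τ + τ) {x y : ι}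
    (hP : ({x, y} : Finset ι) ∈ soloBlindSeqRep h S 2 τ) :
    (soloBlindSeqRep h S 3 τ).card ≤ (soloBlindSeqRep h (S \ {x, y}) 2 (h y)).card +
      (soloBlindSeqRep h (S \ {x, y}) 2 (h x)).card := by
  obtain ⟨hPS, hPc, hPsum⟩ := soloBlind_mem_seqRep.mp hP
  have hxy : x ≠ y := by
    intro e; rw [e] at hPc; simp at hPc
  rw [Finset.sum_pair hxy] at hPsum
  -- the link through a point z of the pair, the other point being z'
  have link : ∀ {z z' : ι} {M : Finset ι}, ({z, z'} : Finset ι) = {x, y} → h z + h z' = τ →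
      M ∈ soloBlindSeqRep h S 3 τ → z ∈ M → z' ∉ M →
      M ∈ (soloBlindSeqRep h (S \ {x, y}) 2 (h z')).image (fun Q => insert z Q) := by
    intro z z' M hzz' hs hM hzM hz'M
    obtain ⟨hMS, hMc, hMsum⟩ := soloBlind_mem_seqRep.mp hM
    rw [Finset.mem_image]
    refine ⟨M.erase z, ?_, Finset.insert_erase hzM⟩
    rw [soloBlind_mem_seqRep]
    refine ⟨?_, by rw [Finset.card_erase_of_mem hzM, hMc], ?_⟩
    · intro w hw
      rw [Finset.mem_sdiff, ← hzz']
      refine ⟨hMS (Finset.mem_of_mem_erase hw), ?_⟩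
      intro hw'
      simp only [Finset.mem_insert, Finset.mem_singleton] at hw'
      rcases hw' with hw' | hw'
      · exact (Finset.mem_erase.mp hw).1 hw'
      · exact hz'M (hw' ▸ Finset.mem_of_mem_erase hw)
    · have e := Finset.add_sum_erase M h hzM
      rw [hMsum, ← hs] at e
      exact add_left_cancel e
  have hcover : soloBlindSeqRep h S 3 τ ⊆
      (soloBlindSeqRep h (S \ {x, y}) 2 (h y)).image (fun Q => insert x Q) ∪
        (soloBlindSeqRep h (S \ {x, y}) 2 (h x)).image (fun Q => insert y Q) := by
    intro M hM
    rw [Finset.mem_union]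
    by_cases hxM : x ∈ M
    · have hyM : y ∉ M := fun hyM => soloBlind_triple_not_both zsf hP hM hxM hyM
      exact Or.inl (link rfl hPsum hM hxM hyM)
    · have hyM : y ∈ M := by
        by_contra hyM
        refine soloBlind_hgood_not_disjoint hgood hM hP (Finset.disjoint_right.mpr ?_)
        intro w hw
        simp only [Finset.mem_insert, Finset.mem_singleton] at hw
        rcases hw with hw | hw
        · rw [hw]; exact hxM
        · rw [hw]; exact hyM
      exact Or.inr (link (Finset.pair_comm y x) (by rw [add_comm]; exact hPsum) hM hyM hxM)
  calc (soloBlindSeqRep h S 3 τ).card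
      ≤ ((soloBlindSeqRep h (S \ {x, y}) 2 (h y)).image (fun Q => insert x Q) ∪
          (soloBlindSeqRep h (S \ {x, y}) 2 (h x)).image (fun Q => insert y Q)).card :=
        Finset.card_le_card hcover
    _ ≤ ((soloBlindSeqRep h (S \ {x, y}) 2 (h y)).image (fun Q => insert x Q)).card +
          ((soloBlindSeqRep h (S \ {x, y}) 2 (h x)).image (fun Q => insert y Q)).card :=
        Finset.card_union_le _ _
    _ ≤ (soloBlindSeqRep h (S \ {x, y}) 2 (h y)).card +
          (soloBlindSeqRep h (S \ {x, y}) 2 (h x)).card :=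
        Nat.add_le_add Finset.card_image_le Finset.card_image_le

omit [DecidableEq G] in
/-- If `y ∈ S ∖ S'` then `S'` is H-good for `h y`: a sub-sum `h y + h y` over `S'` plus `y` would be a zero-sum. -/
theorem soloBlind_hgood_of_outside_value (three : ∀ g : G, g + g + g = 0) {h : ι → G} {S S' : Finset ι}
    (zsf : ∀ T ⊆ S, T.Nonempty → ∑ i ∈ T, h i ≠ 0)
    (hS' : S' ⊆ S) {y : ι} (hyS : y ∈ S) (hyS' : y ∉ S') :
    ∀ T ⊆ S', ∑ i ∈ T, h i ≠ h y + h y := by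
  intro T hT hsum
  have hyT : y ∉ T := fun hyT => hyS' (hT hyT)
  have hZ : ∑ i ∈ insert y T, h i = 0 := by
    rw [Finset.sum_insert hyT, hsum, ← add_assoc]; exact three (h y)
  exact zsf _ (Finset.insert_subset hyS (hT.trans hS')) (Finset.insert_nonempty y T) hZ

end Summit.MatrixMultiplication.MatrixMultiplication.Theorems
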